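import Mathlib
import HarnessLib
import Summits.HubbardSuperconductivity.HubbardSuperconductivity.Theorems.KLProgrammeKLRegimeWickSecondOrder
import Summits.HubbardSuperconductivity.HubbardSuperconductivity.Theorems.KLProgrammeKLRegimeWickEffectiveActionLegDressing
import Summits.HubbardSuperconductivity.HubbardSuperconductivity.Theorems.KLProgrammeKLRegimeSplitTwoLegIncrementRep

/-!
# Route `KLProgramme` — crux C4a, S1 (a): the SECOND CUMULANT of a Gaussian convolution has ONLY CROSS CONTRACTIONS between the two dressed copies —
# `e^{Δ_C}(W·W) − e^{Δ_C}W·e^{Δ_C}W = dblFold((e^{Δ_×(C)} − 1)(W̃⁰·W̃¹))`, `W̃ = e^{Δ_C}W`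

Cell `gate-hubbard-kl`, lane hubbard-kl-c4a-1 (g5); helper for stub (C) `stub_twoLeg_curvature` of the engine-flow child `KLRegimeEngineV17F2`
(stmt-HubbardSuperconductivity-20437); memo HOME/hubbard-kl-c4a-1/C4A-PLAN.md §22.10 (S1 map, step (a)).  The two-vertex term of `kernel_effAction_split₃`
(…KLRegimeSplitTwoLegIncrementRep §4) is `−½·kernel(e^{Δ_C}(W·W) − e^{Δ_C}W·e^{Δ_C}W)`.  By p1's Wick star product (`wickStar C a b = e^{Δ_C}((e^{−Δ_C}a)(e^{−Δ_C}b))`,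
`wickStar_eq_dblFold_gaussConv_cross`: only the CROSS Laplacian acts) applied to the DRESSED vertex `W̃ = e^{Δ_C}W`:
`e^{Δ_C}(W·W) = W̃ ⋆_C W̃ = dblFold(e^{Δ_×(C)}(W̃⁰W̃¹))` and `W̃·W̃ = dblFold(W̃⁰W̃¹)`, so the second cumulant is the fold of `(e^{Δ_×(C)} − 1)(W̃⁰W̃¹)` — every term has
AT LEAST ONE line between the two copies and none inside a copy (the self-contractions are all in `W̃`).  For the tadpole vertex of `𝒱_n` at second order
(`C = C^K_{>Λ_n}`, `W = V_U + 𝒩_K`, `W̃ = W + Δ_C W + ½Δ_C²W`) this is the entry point of S1 (b): the 4-leg kernel at tadpole legs via `kernel_dblFold` and the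
colouring rules (…KLRegimeWickBubbleRule).

* `secondCumulant_eq_dblFold_cross` (generic: commutative `ℚ`-algebra, finite labels, EVEN `W`);
* `klEffectiveAction_secondCumulant_eq_dblFold_cross` (the model instance at scale `n`: `W = 𝒱_n[K]`, any covariance `C`).

Exact algebra; nothing about sizes; nothing asserts superconductivity.  References: Salmhofer 1999 §2.3 (2.53), §4.2 [cite: Salmhofer1999];
BGM 2006 §2.2 (2.12)–(2.14) [cite: BenfattoGiulianiMastropietro2006].
-/

noncomputable section

namespace Summit.HubbardSuperconductivity.HubbardSuperconductivity.Theorems.C4a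

set_option linter.dupNamespace false -- summit = problem name (single-conjunct summit), D-0017

open Literature.MathematicalPhysics.QuantumLattice Literature.Probability.LatticeModels GrassmannAlgebra Finset Matrix
open Summit.HubbardSuperconductivity.HubbardSuperconductivity.Theorems.KLRegimeWick
open Summit.HubbardSuperconductivity.HubbardSuperconductivity.Theorems.KLRegimeSplit
open Summit.HubbardSuperconductivity.HubbardSuperconductivity.Theorems.KLProgrammeLegKernels

section Generic

variable (R : Type*) [CommRing R] [Algebra ℚ R] {Γ : Type*} [Fintype Γ] [DecidableEq Γ]

/-- **The second cumulant has only cross contractions between the dressed copies**: for EVEN `W` and any covariance `C`,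
`e^{Δ_C}(W·W) − e^{Δ_C}W·e^{Δ_C}W = dblFold((e^{Δ_{crossCov C}} − 1)(dblCopy 0 W̃ · dblCopy 1 W̃))`, `W̃ = e^{Δ_C}W`. [cite: Salmhofer1999, §2.3 (2.53)] -/
theorem secondCumulant_eq_dblFold_cross (C : Matrix Γ Γ R) {W : GrassmannAlgebra R Γ} (hW : W ∈ evenOdd R 0) :
    gaussConv R C (W * W) - gaussConv R C W * gaussConv R C W =
      dblFold R ((gaussConv R (crossCov R C) - 1) (dblCopy R 0 (gaussConv R C W) * dblCopy R 1 (gaussConv R C W))) := by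
  have hWt : gaussConv R C W ∈ evenOdd R 0 := gaussConv_mem_evenOdd R C hW
  have hstar : wickStar R C (gaussConv R C W) (gaussConv R C W) = gaussConv R C (W * W) := by
    rw [wickStar, gaussConv_neg_gaussConv_apply]
  rw [← hstar, wickStar_eq_dblFold_gaussConv_cross R C hWt, LinearMap.sub_apply, Module.End.one_apply, map_sub, dblFold_copy_mul_copy]

end Generic

section Model

variable {L M : ℕ} [NeZero L] [NeZero M]

omit [NeZero M] in
/-- **The model instance**: for the scale-`n` one-shot action `𝒱_n[K] = klEffectiveAction L M β U μ K e₀ n` (EVEN, `klEffectiveAction_mem_evenOdd_zero`) and ANY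
covariance `C` (e.g. the slice `S_{n+1}[K]` of `kernel_two_klEffectiveAction_succ_sub_eq₃`, or `C^K_{>Λ_n}` for `𝒱_n`'s own second-order part):
`e^{Δ_C}(𝒱_n·𝒱_n) − e^{Δ_C}𝒱_n·e^{Δ_C}𝒱_n = dblFold((e^{Δ_×(C)} − 1)(𝒱̃_n⁰·𝒱̃_n¹))`, `𝒱̃_n = e^{Δ_C}𝒱_n`. -/
theorem klEffectiveAction_secondCumulant_eq_dblFold_cross (β U μ : ℝ) (K : TrigPolyC4v) (e₀ : ℝ) (n : ℕ)
    (C : Matrix (HubbardFieldIdx L M) (HubbardFieldIdx L M) ℂ) :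
    gaussConv ℂ C (klEffectiveAction L M β U μ K e₀ n * klEffectiveAction L M β U μ K e₀ n) -
        gaussConv ℂ C (klEffectiveAction L M β U μ K e₀ n) * gaussConv ℂ C (klEffectiveAction L M β U μ K e₀ n) =
      dblFold ℂ ((gaussConv ℂ (crossCov ℂ C) - 1)
        (dblCopy ℂ 0 (gaussConv ℂ C (klEffectiveAction L M β U μ K e₀ n)) * dblCopy ℂ 1 (gaussConv ℂ C (klEffectiveAction L M β U μ K e₀ n)))) :=
  secondCumulant_eq_dblFold_cross ℂ C (klEffectiveAction_mem_evenOdd_zero β U μ K e₀ n)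

end Model

end Summit.HubbardSuperconductivity.HubbardSuperconductivity.Theorems.C4a

end
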